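import Literature.NumberTheory.EllipticCurves.Kato2004.IwasawaH1CoeffLambdaTorsionProofs
import Literature.NumberTheory.EllipticCurves.Kato2004.IwasawaH1CoeffRingLemmasProofs
import Mathlib.RingTheory.PowerSeries.WeierstrassPreparation
import HarnessLib

/-!
# Kato 2004 (Astérisque 295) Thm. 12.4 (2) for `𝒪_λ`-lattices: `𝐇¹_Γ(T_ρ)` is a TORSION-FREE
# `Λ_𝒪`-module, modulo bounded `Gal(ℚ̄/ℚ_∞)`-invariants of `T_ρ ⊗ ℚ/T_ρ` (proofs only)

Topic `NumberTheory/EllipticCurves`, sub-directory `Kato2004` (namespace = path).  THEOREMS ONLY.  The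
`Λ_𝒪`-ASSEMBLY of seat `bsd-wall-tp2-p2x-w2` g23's files on the print leaf K0b
(`Kato2004.thm12_4_newform`, item stmt-BirchSwinnertonDyer-24115, conjunct of `stub_printInputs` of crux
stmt-BirchSwinnertonDyer-22608): `IwasawaH1CoeffTorsionFreeProofs` (constant part, unconditional),
`IwasawaCohomologyCoeffRigidityProofs` (forced level action), `IwasawaH1CoeffTowerEngineProofs` /
`IwasawaH1CoeffLambdaTorsionProofs` (no `ω_j`-torsion, no prime-to-`ω` torsion, under (HYP_J)),
`IwasawaH1CoeffRingLemmasProofs` (`𝒪` a complete DVR, resultant dichotomy).  For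
`𝒪 = padicCoeffIntegers S` (`ℚ_p(S)/ℚ_p` finite), `ρ : Γ_ℚ → GL_n(𝒪)` (`FramedGaloisRep ℚ 𝒪 n`), a
`ℤ_p`-extension `κ` with topological generator `γ`, a pin `I : IwasawaH1DataCoeff ρ.toGaloisRep p κ γ` of
`𝐇¹_Γ(T_ρ)` over `Λ_𝒪 = IwasawaAlgebraO S = 𝒪⟦X⟧`, and the element-wise hypothesis

  (HYP_J) every `m ∈ 𝒪ⁿ` fixed by `Gal(ℚ̄/ℚ_∞)` modulo `p^{j+J} 𝒪ⁿ` lies in `p^j 𝒪ⁿ` (all `j`)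
  — i.e. `(T_ρ ⊗ ℚ/T_ρ)^{Gal(ℚ̄/ℚ_∞)}` is killed by `p^J`; implied by "`T_ρ` has no non-zero
  `Gal(ℚ̄/ℚ_∞)`-fixed vector" (compactness), which for a lattice of `V_{F_λ}(g)(1)` is PRINT
  (purity, Kato (14.10.5); or Ribet irreducibility) —

* §1 GENERIC ASSEMBLY over any local coefficient ring `A` with principal maximal ideal `𝔪 = (ϖ) ∋ p`,
  `𝔪`-adically complete, `M` Noetherian and `p`-adically complete, given the resultant DICHOTOMY
  (every monic `P` of positive degree and every `ω_n`: a power of `p` in `(P, ω_n)`, or a common monic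
  factor): `eq_zero_of_monic_smul_eq_zero_of_dichotomy` (strong induction on the degree: coprime case,
  or split off the common factor and use "no `ω_m`-torsion"), `eq_zero_of_smul_eq_zero_of_dichotomy`
  (Weierstrass preparation `f = P h` when `f ≢ 0 (mod 𝔪)`, else `f = C(ϖ) f'` and the constant part),
  `isTorsionFree_of_boundedInvariants_of_dichotomy` (`Module.IsTorsionFree A⟦X⟧ I.H`) — reusable for
  `A = ℤ_p`, `T = T_pE`;
* §2 **`isTorsionFree_of_boundedInvariants`** — `𝒪 = padicCoeffIntegers S`: `Module.IsTorsionFree Λ_𝒪 I.H`;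
* **`isTorsionFree_newform_of_boundedInvariants`** — the same on the binders of `thm12_4_newform`
  (newform `g`, `ι`, `ρ`, `κ` cyclotomic, `γ`): the middle conjunct of K0b, modulo (HYP_J) for `ρ`.

HONEST FRAMING: K0b's clause (b) is now a kernel theorem MODULO ONE element-wise hypothesis on `ρ`
((HYP_J)); the clauses (12.2.1) (finite generation) and "rank one" are untouched; `thm12_4_newform`
stays a named fact; BSD is not advanced by this file.

## References

* [Kato2004Asterisque] K. Kato, Astérisque 295 (2004): Thm. 12.4 (2) (p. 221), §13.8 (pp. 228–229),
  (14.10.5) (p. 241).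
* [Washington1997] L. C. Washington, *Introduction to Cyclotomic Fields* (1997), Thm. 7.3.
-/

noncomputable section

open scoped NumberField
open Field CategoryTheory Topology Polynomial
open Literature.NumberTheory.GaloisRepresentations
open Literature.NumberTheory.EllipticCurves Literature.NumberTheory.EllipticCurves.Kato2004
open Literature.NumberTheory.EllipticCurves.Kato2004.EulerSystemValues

namespace Literature.NumberTheory.EllipticCurves.Kato2004

/-! ## §1 Generic assembly: a complete local coefficient ring with principal maximal ideal -/

namespace IwasawaH1DataCoeff

open IwasawaH1CoeffTorsionFree

section Generic

variable {A : Type} [CommRing A] [TopologicalSpace A] {M : Type} [AddCommGroup M] [Module A M]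
  [TopologicalSpace M] [IsTopologicalAddGroup M] [ContinuousSMul A M]
  {T : GaloisRep ℚ A M} {p : ℕ} [Fact p.Prime] {κ : ZpExtension ℚ p} {γ : absoluteGaloisGroup ℚ}

/-- **Monic polynomials are `𝐇¹_Γ(T)`-regular under (HYP_J), given the resultant dichotomy.**  Generic
coefficient ring `A` (`M` Noetherian, `p` acting by an embedding, `M` `p`-adically precomplete and
separated), any pin `I`, (HYP_J), and the DICHOTOMY hypothesis `hdich`: for every monic `P` of positive
degree and every `n`, either `(P, ω_n) ⊆ A[X]` contains a power of `p` or `P` and `ω_n` have a common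
monic factor of positive degree (true over the integers of a `p`-adic field: resultants, `minpoly`).  Then
every monic `P ∈ A[X]` acts injectively on `I.H`: strong induction on `deg P` — coprime case by
`eq_zero_of_polynomial_smul_eq_zero`; else `P = Q P₁`, `ω_m = Q W`, so `ω_m • (P₁ • x) = W • (P • x) = 0`,
`P₁ • x = 0` by `eq_zero_of_omega_smul_eq_zero`, and induction.
[cite: Kato2004Asterisque, Thm. 12.4 (2) (p. 221) and §13.8 (pp. 228–229)] -/
theorem eq_zero_of_monic_smul_eq_zero_of_dichotomy [IsNoetherian A M] (I : IwasawaH1DataCoeff T p κ γ)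
    (hγ : κ.IsTopGenerator γ) (ha : IsEmbedding fun v : M ↦ (p : A) • v) (J : ℕ)
    (hJ : ∀ (j : ℕ) (m : M), (∀ g ∈ κ.kerSubgroup, ∃ t : M, (p : A) ^ (j + J) • t = T g m - m) →
      ∃ t : M, (p : A) ^ j • t = m)
    (hprec : ∀ f : ℕ → M, (∀ k, ∃ t : M, (p : A) ^ k • t = f (k + 1) - f k) →
      ∃ L : M, ∀ k, ∃ t : M, (p : A) ^ k • t = f k - L)
    (hhaus : ∀ m : M, (∀ k, ∃ t : M, (p : A) ^ k • t = m) → m = 0)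
    (hdich : ∀ (P : A[X]), P.Monic → 0 < P.natDegree → ∀ n : ℕ,
      (∃ (U V : A[X]) (k : ℕ), U * P + V * ((X + 1 : A[X]) ^ p ^ n - 1) = C ((p : A) ^ k)) ∨
      (∃ Q P₁ W : A[X], Q.Monic ∧ 0 < Q.natDegree ∧ P = Q * P₁ ∧
        ((X + 1 : A[X]) ^ p ^ n - 1) = Q * W))
    (d : ℕ) : ∀ (P : A[X]), P.Monic → P.natDegree = d →
      ∀ x : I.H, (P : PowerSeries A) • x = 0 → x = 0 := by
  induction d using Nat.strong_induction_on with
  | _ d ih =>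
    intro P hP hd x hx
    rcases Nat.eq_zero_or_pos d with rfl | hdpos
    · rw [Polynomial.eq_one_of_monic_natDegree_zero hP hd, Polynomial.coe_one, one_smul] at hx
      exact hx
    by_cases hcop : ∀ m : ℕ, ∃ (U V : A[X]) (k : ℕ),
        U * P + V * ((X + 1 : A[X]) ^ p ^ m - 1) = C ((p : A) ^ k)
    · -- `P` prime to every `ω_m`: the coprime case
      exact I.eq_zero_of_polynomial_smul_eq_zero hγ ha J hJ P hcop x hx
    · -- a common monic factor with some `ω_m`
      push Not at hcop
      obtain ⟨m, hm⟩ := hcop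
      rcases hdich P hP (hd ▸ hdpos) m with ⟨U, V, k, hUV⟩ | ⟨Q, P₁, W, hQ, hQ0, hPQ, hωQ⟩
      · exact absurd hUV (hm U V k)
      have hP₁ : P₁.Monic := hQ.of_mul_monic_left (hPQ ▸ hP)
      have hdeg : P₁.natDegree < d := by
        rw [← hd, hPQ, hQ.natDegree_mul hP₁]; omega
      -- `ω_m • (P₁ • x) = W • (P • x) = 0`, so `P₁ • x = 0` (no `ω_m`-torsion), then induction
      have hω : ((((X + 1 : A[X]) ^ p ^ m - 1 : A[X])) : PowerSeries A) • ((P₁ : PowerSeries A) • x)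
          = 0 := by
        rw [hωQ, Polynomial.coe_mul, mul_comm, mul_smul, ← mul_smul (Q : PowerSeries A),
          ← Polynomial.coe_mul, ← hPQ, hx, smul_zero]
      exact ih P₁.natDegree hdeg P₁ hP₁ rfl x (I.eq_zero_of_omega_smul_eq_zero hγ J hJ hprec hhaus m _ hω)

/-- **Every non-zero `f ∈ A⟦X⟧` is `𝐇¹_Γ(T)`-regular under (HYP_J)** — generic assembly over a LOCAL
coefficient ring `A`, `𝔪`-adically complete with PRINCIPAL maximal ideal `𝔪 = (ϖ) ∋ p` (`ϖ` acting on `M`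
by an embedding), with the side conditions of `eq_zero_of_monic_smul_eq_zero_of_dichotomy`.  Induction on
`k` such that a coefficient of `f` lies outside `𝔪^k` (Krull): if `f ≡ 0 (mod 𝔪)` then `f = C(ϖ) f'`
and `ϖ` is `𝐇¹`-regular by the UNCONDITIONAL constant part `eq_zero_of_C_smul_eq_zero` (`p ∈ (ϖ)`);
otherwise WEIERSTRASS PREPARATION (Mathlib `PowerSeries.exists_isWeierstrassFactorization`) gives
`f = P h`, `P` distinguished (monic), `h` a unit, and the monic case applies.
[cite: Kato2004Asterisque, Thm. 12.4 (2) (p. 221)] [cite: Washington1997, Thm. 7.3] -/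
theorem eq_zero_of_smul_eq_zero_of_dichotomy [IsNoetherian A M] [IsLocalRing A]
    [IsAdicComplete (IsLocalRing.maximalIdeal A) A] (I : IwasawaH1DataCoeff T p κ γ)
    (hγ : κ.IsTopGenerator γ) {ϖ : A} (hϖ : IsLocalRing.maximalIdeal A = Ideal.span {ϖ})
    (hpm : (p : A) ∈ IsLocalRing.maximalIdeal A) (hϖemb : IsEmbedding fun v : M ↦ ϖ • v)
    (ha : IsEmbedding fun v : M ↦ (p : A) • v) (J : ℕ)
    (hJ : ∀ (j : ℕ) (m : M), (∀ g ∈ κ.kerSubgroup, ∃ t : M, (p : A) ^ (j + J) • t = T g m - m) →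
      ∃ t : M, (p : A) ^ j • t = m)
    (hprec : ∀ f : ℕ → M, (∀ k, ∃ t : M, (p : A) ^ k • t = f (k + 1) - f k) →
      ∃ L : M, ∀ k, ∃ t : M, (p : A) ^ k • t = f k - L)
    (hhaus : ∀ m : M, (∀ k, ∃ t : M, (p : A) ^ k • t = m) → m = 0)
    (hdich : ∀ (P : A[X]), P.Monic → 0 < P.natDegree → ∀ n : ℕ,
      (∃ (U V : A[X]) (k : ℕ), U * P + V * ((X + 1 : A[X]) ^ p ^ n - 1) = C ((p : A) ^ k)) ∨
      (∃ Q P₁ W : A[X], Q.Monic ∧ 0 < Q.natDegree ∧ P = Q * P₁ ∧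
        ((X + 1 : A[X]) ^ p ^ n - 1) = Q * W))
    {f : PowerSeries A} (hf : f ≠ 0) (x : I.H) (hx : f • x = 0) : x = 0 := by
  -- `p ∈ (ϖ)`: the constant part applies to `ϖ`
  have hpϖ : (p : A) ^ 1 ∈ Ideal.span {ϖ} := by rw [pow_one, ← hϖ]; exact hpm
  -- induction on `k` with: some coefficient of `g` lies outside `𝔪^k`
  have key : ∀ (k : ℕ) (g : PowerSeries A),
      (∃ i, PowerSeries.coeff i g ∉ IsLocalRing.maximalIdeal A ^ k) → ∀ y : I.H, g • y = 0 → y = 0 := by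
    intro k
    induction k with
    | zero =>
      rintro g ⟨i, hi⟩
      exact absurd (by rw [pow_zero, Ideal.one_eq_top]; exact Submodule.mem_top) hi
    | succ k ih =>
      rintro g ⟨i, hi⟩ y hy
      by_cases hres : g.map (IsLocalRing.residue A) = 0
      · -- all coefficients in `𝔪 = (ϖ)`: `g = C ϖ * g'`, and `ϖ` is `𝐇¹`-regular (constant part)
        have hcoeff : ∀ j, ∃ c, PowerSeries.coeff j g = ϖ * c := fun j ↦ by
          have h := congrArg (PowerSeries.coeff j) hres
          rw [PowerSeries.coeff_map, map_zero, IsLocalRing.residue_eq_zero_iff, hϖ,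
            Ideal.mem_span_singleton'] at h
          obtain ⟨c, hc⟩ := h
          exact ⟨c, by rw [← hc, mul_comm]⟩
        choose c hc using hcoeff
        have hg : g = PowerSeries.C ϖ * PowerSeries.mk c := by
          ext j; rw [PowerSeries.coeff_C_mul, PowerSeries.coeff_mk, hc]
        have hi' : PowerSeries.coeff i (PowerSeries.mk c) ∉ IsLocalRing.maximalIdeal A ^ k := by
          intro hmem
          apply hi
          rw [hc, pow_succ']
          exact Ideal.mul_mem_mul (hϖ ▸ Ideal.mem_span_singleton_self ϖ) (by simpa using hmem)
        rw [hg, mul_smul] at hy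
        exact ih _ ⟨i, hi'⟩ y (I.eq_zero_of_C_smul_eq_zero hϖemb hpϖ _ hy)
      · -- Weierstrass preparation: `g = P h`, `P` distinguished (monic), `h` a unit
        obtain ⟨P, h, H⟩ := PowerSeries.exists_isWeierstrassFactorization hres
        obtain ⟨u, hu⟩ := H.isUnit
        have hPy : (P : PowerSeries A) • (h • y) = 0 := by rw [← mul_smul, ← H.eq_mul, hy]
        have hhy : h • y = 0 :=
          I.eq_zero_of_monic_smul_eq_zero_of_dichotomy hγ ha J hJ hprec hhaus hdich P.natDegree P
            H.isDistinguishedAt.monic rfl _ hPy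
        rw [← hu] at hhy
        simpa using congrArg (fun z ↦ (↑u⁻¹ : PowerSeries A) • z) hhy
  -- some coefficient of `f ≠ 0` is non-zero, hence outside some `𝔪^k` (Krull)
  obtain ⟨i, hi⟩ : ∃ i, PowerSeries.coeff i f ≠ 0 := by
    by_contra h
    push Not at h
    exact hf (PowerSeries.ext fun i ↦ by rw [h i, map_zero])
  obtain ⟨k, hk⟩ : ∃ k, PowerSeries.coeff i f ∉ IsLocalRing.maximalIdeal A ^ k := by
    by_contra h
    push Not at h
    exact hi (IsHausdorff.haus (inferInstance : IsHausdorff (IsLocalRing.maximalIdeal A) A) _ fun k ↦ by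
      rw [SModEq.sub_mem, sub_zero, smul_eq_mul, Ideal.mul_top]; exact h k)
  exact key k f ⟨i, hk⟩ x hx

/-- **`𝐇¹_Γ(T)` is a torsion-free `A⟦X⟧`-module under (HYP_J)** — generic form (`A` a domain, local,
`𝔪 = (ϖ) ∋ p`, `𝔪`-adically complete; `M` Noetherian, `p`-adically precomplete and separated, `ϖ` and `p`
acting by embeddings; the resultant dichotomy `hdich`): `Module.IsTorsionFree A⟦X⟧ I.H`.
[cite: Kato2004Asterisque, Thm. 12.4 (2) (p. 221) and §13.8 (pp. 228–229)] -/
theorem isTorsionFree_of_boundedInvariants_of_dichotomy [IsNoetherian A M] [IsDomain A] [IsLocalRing A]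
    [IsAdicComplete (IsLocalRing.maximalIdeal A) A] (I : IwasawaH1DataCoeff T p κ γ)
    (hγ : κ.IsTopGenerator γ) {ϖ : A} (hϖ : IsLocalRing.maximalIdeal A = Ideal.span {ϖ})
    (hpm : (p : A) ∈ IsLocalRing.maximalIdeal A) (hϖemb : IsEmbedding fun v : M ↦ ϖ • v)
    (ha : IsEmbedding fun v : M ↦ (p : A) • v) (J : ℕ)
    (hJ : ∀ (j : ℕ) (m : M), (∀ g ∈ κ.kerSubgroup, ∃ t : M, (p : A) ^ (j + J) • t = T g m - m) →
      ∃ t : M, (p : A) ^ j • t = m)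
    (hprec : ∀ f : ℕ → M, (∀ k, ∃ t : M, (p : A) ^ k • t = f (k + 1) - f k) →
      ∃ L : M, ∀ k, ∃ t : M, (p : A) ^ k • t = f k - L)
    (hhaus : ∀ m : M, (∀ k, ∃ t : M, (p : A) ^ k • t = m) → m = 0)
    (hdich : ∀ (P : A[X]), P.Monic → 0 < P.natDegree → ∀ n : ℕ,
      (∃ (U V : A[X]) (k : ℕ), U * P + V * ((X + 1 : A[X]) ^ p ^ n - 1) = C ((p : A) ^ k)) ∨
      (∃ Q P₁ W : A[X], Q.Monic ∧ 0 < Q.natDegree ∧ P = Q * P₁ ∧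
        ((X + 1 : A[X]) ^ p ^ n - 1) = Q * W)) :
    Module.IsTorsionFree (PowerSeries A) I.H := by
  refine ⟨fun f hf x y hxy ↦ ?_⟩
  have hf0 : f ≠ 0 := by
    rintro rfl
    exact not_isRegular_zero hf
  rw [← sub_eq_zero]
  refine I.eq_zero_of_smul_eq_zero_of_dichotomy hγ hϖ hpm hϖemb ha J hJ hprec hhaus hdich hf0 (x - y) ?_
  rw [smul_sub, sub_eq_zero]
  exact hxy

end Generic

/-! ## §2 `𝒪_λ`-lattices: `𝐇¹_Γ(T_ρ)` is a torsion-free `Λ_𝒪`-module under (HYP_J) -/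

section PadicCoeff

variable {p : ℕ} [Fact p.Prime] {S : Set (PadicAlgCl p)} [FiniteDimensional ℚ_[p] (padicCoeffField S)]
  {n : ℕ} {ρ : FramedGaloisRep ℚ (padicCoeffIntegers S) n} {κ : ZpExtension ℚ p} {γ : absoluteGaloisGroup ℚ}

omit [FiniteDimensional ℚ_[p] (padicCoeffField S)] in
/-- Non-zero scalars act on `𝒪ⁿ` by topological embeddings (as in the constant-part file). [folklore] -/
private theorem isEmbedding_smul_pi' {a : padicCoeffIntegers S} (ha : a ≠ 0) (n : ℕ) :
    IsEmbedding fun v : (Fin n → padicCoeffIntegers S) ↦ a • v := by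
  have ha' : (a : PadicAlgCl p) ≠ 0 := fun h ↦ ha (Subtype.ext h)
  have hval : IsEmbedding (Subtype.val : padicCoeffIntegers S → PadicAlgCl p) :=
    IsEmbedding.subtypeVal
  have h1 : IsEmbedding (fun x : padicCoeffIntegers S ↦ a * x) := by
    rw [← hval.of_comp_iff]
    exact (Homeomorph.mulLeft₀ (a : PadicAlgCl p) ha').isEmbedding.comp hval
  exact IsEmbedding.piMap fun _ : Fin n ↦ h1

/-- **Kato Thm. 12.4 (2) for `𝒪_λ`-lattices, modulo bounded `Gal(ℚ̄/ℚ_∞)`-invariants: `𝐇¹_Γ(T_ρ)` is a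
TORSION-FREE `Λ_𝒪`-module.**  For `𝒪 = padicCoeffIntegers S` with `ℚ_p(S)/ℚ_p` finite, EVERY
`ρ : Γ_ℚ → GL_n(𝒪)`, every prime `p`, every `ℤ_p`-extension `κ` of `ℚ` with topological generator `γ`
and every pin `I : IwasawaH1DataCoeff ρ.toGaloisRep p κ γ`: if for some `J` every `m ∈ 𝒪ⁿ` fixed by
`Gal(ℚ̄/ℚ_∞)` modulo `p^{j+J}` lies in `p^j 𝒪ⁿ` (all `j`) — i.e. `(T_ρ ⊗ ℚ/T_ρ)^{Gal(ℚ̄/ℚ_∞)}` is killed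
by `p^J`, which holds as soon as `T_ρ` has no non-zero `Gal(ℚ̄/ℚ_∞)`-fixed vector (sibling file
`IwasawaH1CoeffBoundedInvariantsProofs`), e.g. for a lattice of `V_{F_λ}(g)(1)` by purity (Kato
(14.10.5)) — then `Module.IsTorsionFree Λ_𝒪 I.H` (generic assembly, with `𝒪` a complete DVR,
`(p) = 𝔪^e`, `𝒪ⁿ` `p`-adically complete, and the resultant dichotomy of `IwasawaH1CoeffRingLemmasProofs`).
This is the clause "`𝐇¹(T)` is a torsion free `Λ`-module" of Kato's Thm. 12.4 (2) = the middle
conjunct of the named fact `thm12_4_newform` (K0b), now a kernel theorem modulo ONE element-wise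
hypothesis on `ρ`; (12.2.1) finite generation and the rank remain named.
[cite: Kato2004Asterisque, Thm. 12.4 (2) (p. 221), §13.8 (pp. 228–229) and (14.10.5) (p. 241)] -/
theorem isTorsionFree_of_boundedInvariants (I : IwasawaH1DataCoeff ρ.toGaloisRep p κ γ)
    (hγ : κ.IsTopGenerator γ) (J : ℕ)
    (hJ : ∀ (j : ℕ) (m : Fin n → padicCoeffIntegers S),
      (∀ g ∈ κ.kerSubgroup, ∃ t : Fin n → padicCoeffIntegers S,
        ((p : ℕ) : padicCoeffIntegers S) ^ (j + J) • t = ρ.toGaloisRep g m - m) →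
      ∃ t : Fin n → padicCoeffIntegers S, ((p : ℕ) : padicCoeffIntegers S) ^ j • t = m) :
    Module.IsTorsionFree (IwasawaAlgebraO S) I.H := by
  haveI : IsPrincipalIdealRing (padicCoeffIntegers S) := isPrincipalIdealRing_padicCoeffIntegers S
  haveI : IsLocalRing (padicCoeffIntegers S) := isLocalRing_padicCoeffIntegers S
  haveI := IwasawaH1CoeffExists.isAdicComplete_maximalIdeal_padicCoeffIntegers p S
  haveI := isDiscreteValuationRing_padicCoeffIntegers S
  obtain ⟨ϖ, hϖ⟩ := IsDiscreteValuationRing.exists_irreducible (padicCoeffIntegers S)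
  have hp0 : ((p : ℕ) : padicCoeffIntegers S) ≠ 0 := by exact_mod_cast (Fact.out : p.Prime).ne_zero
  refine I.isTorsionFree_of_boundedInvariants_of_dichotomy hγ hϖ.maximalIdeal_eq
    (IwasawaH1CoeffExists.natCast_mem_maximalIdeal_padicCoeffIntegers p S)
    (isEmbedding_smul_pi' hϖ.ne_zero n) (isEmbedding_smul_pi' hp0 n) J hJ
    (exists_limit_of_pow_natCast_smul S n) (eq_zero_of_forall_pow_natCast_smul S n)
    fun P hP hP0 m ↦ ?_
  rcases exists_mul_add_mul_eq_C_pow_or_exists_root S P hP hP0 m with h | ⟨a, haP, haω⟩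
  · exact Or.inl h
  · exact Or.inr (exists_monic_dvd_of_root S P m a haP haω)

/-- **K0b clause (b) on its own binders, modulo (HYP_J).**  For every prime `p`, `g ∈ S₂(Γ₀(M))` with
`IsNewform0 g`, `ι : K_g → ℚ̄_p`, lattice `ρ : Γ_ℚ → GL₂(𝒪)` (`𝒪 = padicCoeffIntegers (Set.range ι)`),
CYCLOTOMIC `κ` with topological generator `γ`, and datum `I : IwasawaH1DataCoeff ρ.toGaloisRep p κ γ`:
if `(T_ρ ⊗ ℚ/T_ρ)^{Gal(ℚ̄/ℚ_∞)}` is killed by `p^J` (element-wise (HYP_J)), then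
`Module.IsTorsionFree Λ_𝒪 I.H` — the middle conjunct of `thm12_4_newform` (the Frobenius hypothesis of
the fact is not needed and not taken; `K_g` is a number field).
[cite: Kato2004Asterisque, Thm. 12.4 (2) (p. 221) and (14.10.5) (p. 241)] -/
theorem isTorsionFree_newform_of_boundedInvariants {p : ℕ} [Fact p.Prime] {M : ℕ} [NeZero M]
    {g : CuspForm (CongruenceSubgroup.Gamma0 M) 2} (ι : ModularForms.coeffField g →+* PadicAlgCl p)
    {ρ : FramedGaloisRep ℚ (padicCoeffIntegers (Set.range ι)) 2}
    {κ : ZpExtension ℚ p} {γ : absoluteGaloisGroup ℚ} (hg : ModularForms.IsNewform0 g)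
    (hγ : κ.IsTopGenerator γ) (I : IwasawaH1DataCoeff ρ.toGaloisRep p κ γ) (J : ℕ)
    (hJ : ∀ (j : ℕ) (m : Fin 2 → padicCoeffIntegers (Set.range ι)),
      (∀ σ ∈ κ.kerSubgroup, ∃ t : Fin 2 → padicCoeffIntegers (Set.range ι),
        ((p : ℕ) : padicCoeffIntegers (Set.range ι)) ^ (j + J) • t = ρ.toGaloisRep σ m - m) →
      ∃ t : Fin 2 → padicCoeffIntegers (Set.range ι),
        ((p : ℕ) : padicCoeffIntegers (Set.range ι)) ^ j • t = m) :
    Module.IsTorsionFree (IwasawaAlgebraO (Set.range ι)) I.H := by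
  haveI : FiniteDimensional ℚ (ModularForms.coeffField g) :=
    ModularForms.IsNewform0.finiteDimensional_coeffField_holds hg
  haveI : FiniteDimensional ℚ_[p] (padicCoeffField (Set.range ι)) :=
    GreenbergSelmer.finiteDimensional_padicCoeffField ι
  exact I.isTorsionFree_of_boundedInvariants hγ J hJ

end PadicCoeff

end IwasawaH1DataCoeff

end Literature.NumberTheory.EllipticCurves.Kato2004

end
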